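import Summits.CriticalPhenomena.PercolationContinuityZ3.Theorems.PercNearOneGluingNoHeavyLowerTailKNGoodSeries
import HarnessLib

/-!
# The gluing kernel GC when the loneliest relay is a PORT of a two-port pendant star (the "port lemma")

Crux `PercNearOneGluingNoHeavy.NoHeavyLowerTail` (stmt-CriticalPhenomena-4575); lemma factory #7 (conditional association),
helper file (`--supports`).  Notation as in prim-hp-2's goodness files: for a weight function `u`, observer `v`, relay `a`, sink `b`,
`agood(u, v; a) := P_u(v ↔ b) − P_u(a ↔ b) + Σ_{W ∩ A = ∅} P_u(C(v) = W) · min_{a′ ∈ A} P_u(a′ ↔ b off W)` (always written out).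

THE KERNEL (LEAD-GEN7 §3a, hp-2's GC = the hypothesis `hGC` of `KNGoodSeries.knGood_series_of_gluing`): `H` a weighted graph,
`x, y ∉ A` two PENDANT STARS (all their pairs of positive weight go to relays), `a₀ ∈ A` the loneliest relay of `H`
(`P_H(a₀ ↔ b) ≤ P_H(a′ ↔ b)` for all `a′ ∈ A`); GC says `agood(H[s(x,y) ↦ 1], x; a₀) ≥ 0` (glue `x` to `y`; the witness `a₀` of the
UNGLUED graph stays a goodness witness).

THEOREM `GCPort.gc_of_twoPort_port` (this file): GC holds whenever `a₀` is a PORT of `x` and `x` has at most one further port `p`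
(`H s(x,v) = 0` for `v ∉ {a₀, p}`), `y` any pendant star (it may share the ports `a₀`, `p`), `K = H − x − y` ARBITRARY.  This covers both minimal open
instances (α) "shared port" and (β) "linked ports" of LEAD-GEN7 §3e (there `A ∖ {b}` = ports, so `a₀` is a port of a two-port star).

PROOF (three tree theorems and conditional association):
* affinity of `agood` in the pair `e = s(x,a₀)` AT the observer (`KNGoodSeries.agood_affine_pair`): the `e ↦ 1` end is `≥ 0` by the
  in-graph gluing transfer (`KNGoodHair.glueTransfer_openConn` with `a = p = a₀`), so it suffices to treat `H[e ↦ 0]` — the star `x′`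
  with the single port `p`;
* CONDITIONAL ASSOCIATION: the minimality of `a₀` survives conditioning on `{e closed}`, a decreasing event of the cluster of `a₀`
  (Kozma–Nitzan Lemma 3(ii), `KozmaNitzan2024_lemma3_ii`); since `x′` is a pendant dead end, this is minimality of `a₀` in `W₀ = H − x`
  (`GCPort.real_openConn_inter_closed`; dead end: `GCPort.update_zero_eq_pinW` + `GCPort.real_openConn_glue_isolated`);
* affinity in the remaining hair `f = s(x,p)` of the glued graph: the `f ↦ 0` end is `agood(W₀, y; a₀) ≥ 0` — Kozma–Nitzan THEOREM 4 for the
  pendant star `y` of `W₀` (`KozmaNitzan2024_thm4_good`) transported by hp-2's corner lemma `KNGoodSeries.agood_wzero_glue_one`; the `f ↦ 1`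
  end is the gluing transfer again (`a₀ ≤ p` in `W₀`).
-/

noncomputable section

namespace Summit.CriticalPhenomena.PercolationContinuityZ3.Theorems

open MeasureTheory Set Literature.Probability.LatticeModels Literature.Probability.Percolation
open scoped Classical BigOperators

variable {n : ℕ}

namespace GCPort

open ChampionStability KNGoodAux KNGoodHair RelayNbhd CILTwoSteiner KNGoodSeries

/-! ### Gluing an isolated vertex to one vertex does not change the other connections -/

/-- Under `w⁰ = pinW w {pairs at o} ∅` (`o` isolated), gluing `o` to `x` does not change `P(a ↔ b)` for `a, b ≠ o`.
[folklore] -/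
theorem real_openConn_glue_isolated (w : Sym2 (Fin n) → unitInterval) {o x a b : Fin n} (hxo : x ≠ o)
    (hao : a ≠ o) (hbo : b ≠ o) :
    (prodBernoulli (Function.update (pinW w {e : Sym2 (Fin n) | o ∈ e ∧ ¬ e.IsDiag} ∅) s(o, x) 1)).real (openConn a b) =
      (prodBernoulli (pinW w {e : Sym2 (Fin n) | o ∈ e ∧ ¬ e.IsDiag} ∅)).real (openConn a b) := by
  haveI : ∀ u : Sym2 (Fin n) → unitInterval, IsProbabilityMeasure (prodBernoulli u) := fun u => inferInstance
  have hox : o ≠ x := fun h => hxo h.symm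
  set w0 : Sym2 (Fin n) → unitInterval := pinW w {e : Sym2 (Fin n) | o ∈ e ∧ ¬ e.IsDiag} ∅ with hw0
  set μ0 := prodBernoulli w0 with hμ0
  set Z : Set (BondConfig (Fin n)) := {ω | ∀ u : Fin n, u ≠ o → s(o, u) ∉ ω} with hZ
  have hZ0 : μ0.real Zᶜ = 0 := real_compl_isolated_eq_zero w o
  rw [hw0, real_update_wzero_one w hxo, ← hw0, ← hμ0]
  refine measureReal_congr_of_null μ0 _ _ Z hZ0 ?_
  ext ω
  simp only [mem_inter_iff, mem_preimage]
  constructor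
  · rintro ⟨h, hω⟩
    refine ⟨?_, hω⟩
    rcases (reachable_insert_iff_of_isolated hox hω hao hbo).1 h with h' | ⟨h', h''⟩
    · exact h'
    · exact h'.trans h''
  · rintro ⟨h, hω⟩; exact ⟨(reachable_insert_iff_of_isolated hox hω hao hbo).2 (Or.inl h), hω⟩

/-! ### One pair: conditioning on `{e closed}` -/

/-- A non-loop pair `e ∋ a` lies in the open edge cluster of `a` iff it is open. [folklore] -/
theorem mk_mem_openEdgeCluster_iff {x a : Fin n} (hxa : x ≠ a) (ω : BondConfig (Fin n)) :
    s(x, a) ∈ openEdgeCluster ω a ↔ s(x, a) ∈ ω := by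
  rw [mem_openEdgeCluster_iff]
  constructor
  · exact fun h => h.1
  · intro h
    refine ⟨h, by rw [Sym2.mk_isDiag_iff]; exact hxa, fun v hv => ?_⟩
    rcases Sym2.mem_iff.1 hv with rfl | rfl
    · have hadj : (openGraph ω).Adj a v := by
        rw [openGraph_adj, Sym2.eq_swap]
        exact ⟨h, fun h' => hxa h'.symm⟩
      exact hadj.reachable
    · exact SimpleGraph.Reachable.refl v

/-- **Conditional association step.**  If `a₀` is no more connected to `b` than `a′`, then the same holds on the event that
the pair `s(x, a₀)` is closed (a decreasing event of the cluster of `a₀`; Kozma–Nitzan Lemma 3(ii)), i.e. for the graph with that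
pair deleted: `P_{H[e↦0]}(a₀ ↔ b) · (1 − H e) ≤ P_{H[e↦0]}(a′ ↔ b) · (1 − H e)`.
[cite: KozmaNitzan2024, Lemma 3(ii) (pp. 6–7)] -/
theorem real_openConn_inter_closed (H : Sym2 (Fin n) → unitInterval) {x a₀ : Fin n} (a' b : Fin n) (hxa : x ≠ a₀)
    (hmin : (prodBernoulli H).real (openConn a₀ b) ≤ (prodBernoulli H).real (openConn a' b)) :
    (1 - (H s(x, a₀) : ℝ)) * (prodBernoulli (Function.update H s(x, a₀) 0)).real (openConn a₀ b) ≤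
      (1 - (H s(x, a₀) : ℝ)) * (prodBernoulli (Function.update H s(x, a₀) 0)).real (openConn a' b) := by
  set 𝒬 : Set (Set (Sym2 (Fin n))) := {C | s(x, a₀) ∉ C} with h𝒬
  have hlow : IsLowerSet 𝒬 := fun C C' hCC' hC hmem => hC (hCC' hmem)
  have key := KozmaNitzan2024_lemma3_ii H a₀ a' b le_rfl (by simpa using hmin) hlow
  have hQ : {ω : BondConfig (Fin n) | openEdgeCluster ω a₀ ∈ 𝒬} = {ω | s(x, a₀) ∉ ω} := by
    ext ω
    simp only [mem_setOf_eq, h𝒬]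
    rw [mk_mem_openEdgeCluster_iff hxa]
  rw [hQ, add_zero, goodStepEI_real_inter_closed_eq, goodStepEI_real_inter_closed_eq] at key
  exact key

/-! ### A pendant dead end does not change the other connections -/

/-- If every non-loop pair at `x` other than `s(x,p)` has weight `0`, then deleting `s(x,p)` too gives `H − x`:
`H[s(x,p) ↦ 0] = pinW H {pairs at x} ∅`. [folklore] -/
theorem update_zero_eq_pinW (H : Sym2 (Fin n) → unitInterval) {x p : Fin n} (hpx : p ≠ x)
    (hx : ∀ v : Fin n, v ≠ p → v ≠ x → H s(x, v) = 0) :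
    Function.update H s(x, p) 0 = pinW H {e : Sym2 (Fin n) | x ∈ e ∧ ¬ e.IsDiag} ∅ := by
  funext e
  by_cases hep : e = s(x, p)
  · subst hep
    rw [Function.update_self, pinW_star_mk H hpx]
  · rw [Function.update_of_ne hep]
    by_cases hmem : e ∈ {e : Sym2 (Fin n) | x ∈ e ∧ ¬ e.IsDiag}
    · rw [pinW_apply_of_mem_of_not_mem H hmem (Set.notMem_empty _)]
      obtain ⟨hxe, hdiag⟩ := hmem
      induction e using Sym2.ind with
      | h u v =>
        rcases Sym2.mem_iff.1 hxe with rfl | rfl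
        · have hvp : v ≠ p := fun h => hep (by rw [h])
          have hvx : v ≠ x := fun h => hdiag (by rw [Sym2.mk_isDiag_iff, h])
          exact hx v hvp hvx
        · have hup : u ≠ p := fun h => hep (by rw [h, Sym2.eq_swap])
          have hux : u ≠ x := fun h => hdiag (by rw [Sym2.mk_isDiag_iff, h])
          rw [Sym2.eq_swap]
          exact hx u hup hux
    · rw [pinW_apply_of_not_mem H ∅ hmem]

/-! ### The port lemma -/

/-- The pocket correction `Σ_{W ∩ A = ∅} P_u(C(x) = W) · min_{a′} P_u(a′ ↔ b off W)` is nonnegative. [folklore] -/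
theorem pocket_nonneg (u : Sym2 (Fin n) → unitInterval) (A : Finset (Fin n)) (hA : A.Nonempty) (x b : Fin n) :
    0 ≤ ∑ W ∈ nullSets A, (prodBernoulli u).real (clusterIs x W) *
        A.inf' hA (fun a' => (prodBernoulli u).real (openConnIn ((↑W : Set (Fin n))ᶜ) a' b)) :=
  Finset.sum_nonneg fun _ _ => mul_nonneg measureReal_nonneg
    ((Finset.le_inf'_iff hA _).2 fun _ _ => measureReal_nonneg)

/-- **The port lemma (GC when the loneliest relay is a port of a two-port pendant star).**
`H` a weighted graph on `Fin n`, `A` the relays, `x, y ∉ A` distinct, `b ≠ x, y`; `x` has positive weight only towards the relays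
`a₀` and `p` (a pendant star with ports `⊆ {a₀, p}`), `y` is a pendant star (positive weight only towards relays; it may touch `a₀` and `p`);
`a₀` is the loneliest relay of `H`: `P_H(a₀ ↔ b) ≤ P_H(a′ ↔ b)` for all `a′ ∈ A`.  Then, in the glued graph `H[s(x,y) ↦ 1]`,
`P(a₀ ↔ b) ≤ P(x ↔ b) + Σ_{W ∩ A = ∅} P(C(x) = W) · min_{a′ ∈ A} P(a′ ↔ b off W)` — the hypothesis `hGC` of
`KNGoodSeries.knGood_series_of_gluing` (hp-2's gluing kernel GC / Conjecture M for this configuration), for an ARBITRARY rest of the graph.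
Proof: affinity in `s(x,a₀)` + gluing transfer; Kozma–Nitzan Lemma 3(ii) (conditional association) to move the minimality of `a₀` to
`H − x`; Kozma–Nitzan Theorem 4 for the pendant star `y` of `H − x`, hp-2's corner transport, affinity in `s(x,p)` + gluing transfer.
Covers every configuration of two pendant stars with `2 + k` ports in which `a₀` is a port of the two-port star — in particular both minimal
open instances (α) shared port / (β) linked ports of the two-lonely-children kernel (LEAD-GEN7 §3e), for any relay graph.
[cite: KozmaNitzan2024, Lemma 3(ii) (pp. 6–7), Thm. 4 (p. 12), Lemma 5 (p. 13)] -/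
theorem gc_of_twoPort_port (H : Sym2 (Fin n) → unitInterval) (A : Finset (Fin n)) (hA : A.Nonempty)
    (x y a₀ p b : Fin n) (hxA : x ∉ A) (hyA : y ∉ A) (hxy : x ≠ y) (ha₀ : a₀ ∈ A) (hp : p ∈ A)
    (hpa : p ≠ a₀) (hbx : b ≠ x)
    (hxpairs : ∀ v : Fin n, v ≠ a₀ → v ≠ p → v ≠ x → H s(x, v) = 0)
    (hypairs : ∀ v : Fin n, v ∉ A → v ≠ y → H s(y, v) = 0)
    (hmin : ∀ a' ∈ A, (prodBernoulli H).real (openConn a₀ b) ≤ (prodBernoulli H).real (openConn a' b)) :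
    (prodBernoulli (Function.update H s(x, y) 1)).real (openConn a₀ b) ≤
      (prodBernoulli (Function.update H s(x, y) 1)).real (openConn x b) +
        ∑ W ∈ nullSets A, (prodBernoulli (Function.update H s(x, y) 1)).real (clusterIs x W) *
          A.inf' hA (fun a' => (prodBernoulli (Function.update H s(x, y) 1)).real (openConnIn ((↑W : Set (Fin n))ᶜ) a' b)) := by
  haveI : ∀ u : Sym2 (Fin n) → unitInterval, IsProbabilityMeasure (prodBernoulli u) := fun u => inferInstance
  -- names
  have hxa : x ≠ a₀ := fun h => hxA (h ▸ ha₀)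
  have hax : a₀ ≠ x := fun h => hxa h.symm
  have hxp : x ≠ p := fun h => hxA (h ▸ hp)
  have hpx : p ≠ x := fun h => hxp h.symm
  have hya' : y ≠ a₀ := fun h => hyA (h ▸ ha₀)
  have hyp : y ≠ p := fun h => hyA (h ▸ hp)
  have hyx : y ≠ x := fun h => hxy h.symm
  -- the goodness functional with observer `x`, witness `a₀`
  set ag : (Sym2 (Fin n) → unitInterval) → ℝ := fun u =>
    (prodBernoulli u).real (openConn x b) - (prodBernoulli u).real (openConn a₀ b) +
      ∑ W ∈ nullSets A, (prodBernoulli u).real (clusterIs x W) *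
        A.inf' hA (fun a' => (prodBernoulli u).real (openConnIn ((↑W : Set (Fin n))ᶜ) a' b)) with hag
  -- the pairs at `x`
  set e : Sym2 (Fin n) := s(x, a₀) with he
  set f : Sym2 (Fin n) := s(x, p) with hf
  set g : Sym2 (Fin n) := s(x, y) with hg
  have hef : e ≠ f := by rw [he, hf]; intro h; exact hpa.symm (Sym2.congr_right.1 h)
  have heg : e ≠ g := by rw [he, hg]; intro h; exact hya'.symm (Sym2.congr_right.1 h)
  have hfg : f ≠ g := by rw [hf, hg]; intro h; exact hyp.symm (Sym2.congr_right.1 h)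
  set H1 : Sym2 (Fin n) → unitInterval := Function.update H g 1 with hH1
  -- goal = `0 ≤ ag H1`
  suffices hgoal : 0 ≤ ag H1 by
    have := hgoal; simp only [hag] at this; linarith
  -- the graph `W₀ = H − x` and the minimality of `a₀` there (conditional association + dead end)
  set W0 : Sym2 (Fin n) → unitInterval := pinW H {d : Sym2 (Fin n) | x ∈ d ∧ ¬ d.IsDiag} ∅ with hW0
  set H' : Sym2 (Fin n) → unitInterval := Function.update H e 0 with hH'
  have hH'f0 : Function.update H' f 0 = W0 := by
    rw [hH', hf, hW0, ← pinW_star_update H hax (0 : unitInterval), ← he]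
    refine update_zero_eq_pinW (Function.update H e 0) hpx fun v hvp hvx => ?_
    by_cases hva : v = a₀
    · subst hva; rw [← he, Function.update_self]
    · rw [Function.update_of_ne (show s(x, v) ≠ e by rw [he]; intro h; exact hva (Sym2.congr_right.1 h))]
      exact hxpairs v hva hvp hvx
  have hdead : ∀ c : Fin n, c ≠ x → (prodBernoulli H').real (openConn c b) = (prodBernoulli W0).real (openConn c b) := by
    intro c hcx
    rw [stub_oneBondDecomp_k15 n H' f (openConn c b), hH'f0,
      show Function.update H' f 1 = Function.update W0 f 1 by rw [← hH'f0, Function.update_idem], hW0, hf,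
      real_openConn_glue_isolated H hpx hcx hbx]
    ring
  have hminW0 : (H e : ℝ) < 1 → ∀ a' ∈ A, (prodBernoulli W0).real (openConn a₀ b) ≤ (prodBernoulli W0).real (openConn a' b) := by
    intro hlt a' ha'
    have hax' : a' ≠ x := fun h => hxA (h ▸ ha')
    have key := real_openConn_inter_closed H a' b hxa (hmin a' ha')
    rw [← he, ← hH', hdead a₀ hax, hdead a' hax'] at key
    have hpos : 0 < 1 - (H e : ℝ) := by linarith
    exact le_of_mul_le_mul_left key hpos
  -- (C) the `e ↦ 0` end: `0 ≤ ag (H1[e ↦ 0])` when `H e < 1`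
  have hC : (H e : ℝ) < 1 → 0 ≤ ag (Function.update H1 e 0) := by
    intro hlt
    have hminW := hminW0 hlt
    -- Theorem 4 for the pendant star `y` of `W₀`
    have hiso : ∀ u : Fin n, u ≠ y → u ∉ A → W0 s(y, u) = 0 := by
      intro u huy huA
      by_cases hux : u = x
      · subst hux; rw [hW0, Sym2.eq_swap]; exact pinW_star_mk H hyx
      · rw [hW0, pinW_apply_of_not_mem H ∅ (show s(y, u) ∉ {d : Sym2 (Fin n) | x ∈ d ∧ ¬ d.IsDiag} from
          fun h => by rcases Sym2.mem_iff.1 h.1 with h' | h' <;> [exact hyx h'.symm; exact hux h'.symm])]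
        exact hypairs u huA huy
    have hgood := KozmaNitzan2024_thm4_good W0 A hA y b hyA hiso
    have hinf : A.inf' hA (fun a' => (prodBernoulli W0).real (openConn a' b)) = (prodBernoulli W0).real (openConn a₀ b) :=
      le_antisymm (Finset.inf'_le _ ha₀) ((Finset.le_inf'_iff hA _).2 hminW)
    rw [KNGood, hinf] at hgood
    -- corner transport: `agood(W₀[g ↦ 1], x; a₀) = agood(W₀, y; a₀) ≥ 0`
    have hcorner := agood_wzero_glue_one H A hA x y a₀ b hxA hyx ha₀ hbx
    rw [← hW0, ← hg] at hcorner
    have hC0 : 0 ≤ ag (Function.update W0 g 1) := by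
      simp only [hag]; rw [hcorner]; linarith
    -- the glued graph with `e` deleted
    set H1' : Sym2 (Fin n) → unitInterval := Function.update H' g 1 with hH1'
    have hH1e : Function.update H1 e 0 = H1' := by
      rw [hH1, hH1', hH', Function.update_comm heg]
    have hH1'f0 : Function.update H1' f 0 = Function.update W0 g 1 := by
      rw [hH1', Function.update_comm hfg.symm, hH'f0]
    have hH1'f1 : Function.update H1' f 1 = Function.update (Function.update W0 g 1) f 1 := by
      rw [← hH1'f0, Function.update_idem]
    -- the `f ↦ 1` end: gluing transfer
    have hC1 : 0 ≤ ag (Function.update H1' f 1) := by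
      have hle : (prodBernoulli (Function.update W0 g 1)).real (openConn a₀ b) ≤
          (prodBernoulli (Function.update W0 g 1)).real (openConn p b) := by
        rw [hW0, hg, real_openConn_glue_isolated H hyx hax hbx, real_openConn_glue_isolated H hyx hpx hbx, ← hW0]
        exact hminW p hp
      have htr := glueTransfer_openConn (Function.update W0 g 1) x p a₀ b hxp hle
      rw [← hf, ← hH1'f1] at htr
      simp only [hag]
      linarith [pocket_nonneg (Function.update H1' f 1) A hA x b]
    -- affinity in `f`
    have haff := agood_affine_pair H1' A hA x p a₀ b (H1' f)
    rw [← hf, Function.update_eq_self] at haff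
    have hf0 : 0 ≤ (H1' f : ℝ) := (H1' f).2.1
    have hf1 : (H1' f : ℝ) ≤ 1 := (H1' f).2.2
    rw [hH1e]
    have hC0' : 0 ≤ ag (Function.update H1' f 0) := by rw [hH1'f0]; exact hC0
    simp only [hag] at hC0' hC1 ⊢
    rw [haff]
    exact add_nonneg (mul_nonneg (by linarith) hC0') (mul_nonneg hf0 hC1)
  -- (B) the `e ↦ 1` end: gluing transfer
  have hB : 0 ≤ ag (Function.update H1 e 1) := by
    have htr := glueTransfer_openConn H1 x a₀ a₀ b hxa le_rfl
    rw [← he] at htr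
    simp only [hag]
    linarith [pocket_nonneg (Function.update H1 e 1) A hA x b]
  -- (A) affinity in `e`
  have haff := agood_affine_pair H1 A hA x a₀ a₀ b (H1 e)
  rw [← he, Function.update_eq_self] at haff
  have hH1e' : H1 e = H e := by rw [hH1, Function.update_of_ne heg]
  have he0 : 0 ≤ (H e : ℝ) := (H e).2.1
  have he1 : (H e : ℝ) ≤ 1 := (H e).2.2
  simp only [hag] at hB ⊢
  rw [haff, hH1e']
  rcases lt_or_eq_of_le he1 with hlt | heq
  · have hC' := hC hlt
    simp only [hag] at hC'
    exact add_nonneg (mul_nonneg (by linarith) hC') (mul_nonneg he0 hB)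
  · rw [heq, sub_self, zero_mul, zero_add, one_mul]
    exact hB

end GCPort

end Summit.CriticalPhenomena.PercolationContinuityZ3.Theorems
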